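import Summits.FinalStateConjecture.FinalStateConjecture.Theorems.SwallowTheDatumUniversalWitnessFamilyRegionOneFlatChart
import Summits.FinalStateConjecture.FinalStateConjecture.Theorems.SwallowTheDatumUniversalWitnessFamilyRegionOneBend

/-!
# Crux `SwallowTheDatum.UniversalWitnessFamily` (stmt-FinalStateConjecture-10051), line `Sketch`,
# stub `stub_regionOneDecomposition` — part 8: the hole chart on its late region

The hole chart of the explicit `N = 1` decomposition of the Schwarzschild exterior is
`Ψ y = holeMap M T₀ y = bentMap M (squashMap T₀ y)` on the boosted Kerr exterior with the trivial motion
`(1, 0)` (reference background `boostedKerrBackground 1 0 M 0`: time `y⁰`, radius `‖ỹ‖`, form `g_{M,0}`).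
On the late region `{y⁰ > T₀ + 1}` it is the bent map `y ↦ y + bend M y⁰ ‖ỹ‖ • e₀`, which is the IDENTITY on
the growing exact zone `{‖ỹ‖ ≤ S(y⁰)}`, `S = exactRadius M`. This file proves, for `T₀` a late time in the
sense of `exists_lateTime` (`|∂_t bend| ≤ 1/2` after `T₀`):

* `Ψ` is `C^∞` and an open embedding on the late region (`contMDiff_holeChart`,
  `isOpenEmbedding_restrict_holeChart`);
* on the exact zone the pullback of `g_{M,0}` along `Ψ` IS `g_{M,0}` (`pullback_holeChart_of_lt`), so the
  extended deviation from the hole background vanishes there with all derivatives and the truncated `Cᵏ`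
  deviations `truncDeviationCk … k R τ` are `0` as soon as `τ > T₀ + 1` and `R < S(τ)`
  (`truncDeviationCk_holeChart_eq_zero`, `tendsto_truncDeviationCk_holeChart`);
* the images of the late region, the time slabs, the truncated slabs and the certified near zone under `Ψ`
  in ingoing Kerr–Schild coordinates (`image_holeChart_lateRegion`, `…_timeSlab`, `…_truncTimeSlab`,
  `…_certified`).

References: Dafermos–Holzegel–Rodnianski–Taylor arXiv:2104.08222, §1 (near-zone deviation on `{t* = τ, r ≤ R}`);
Misner–Thorne–Wheeler 1973, §31.4.
-/

set_option linter.dupNamespace false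

noncomputable section

open scoped Manifold ContDiff Topology
open Set Function Filter Literature.Geometry.Lorentzian

namespace Summit.FinalStateConjecture.FinalStateConjecture.Theorems.SwallowTheDatum.UniversalWitnessFamily

/-! ## The hole background `boostedKerrBackground 1 0 M 0` -/

section Background

variable {M : ℝ}

/-- The hole background's time is ingoing Kerr–Schild time `y⁰`. -/
theorem holeBackground_time (M : ℝ) (y : E4) : (boostedKerrBackground 1 0 M 0).time y = y 0 := by
  show (poincareInv 1 0 y) 0 = y 0
  rw [poincareInv_one_zero]

/-- The hole background's radius is `‖ỹ‖`. -/
theorem holeBackground_radius (M : ℝ) (y : E4) : (boostedKerrBackground 1 0 M 0).radius y = E4.spatialNorm y := by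
  show Kerr.radius 0 (poincareInv 1 0 y) = _
  rw [poincareInv_one_zero, Kerr.radius_zero_left]

/-- The hole background's form is the Schwarzschild Kerr–Schild form. -/
theorem holeBackground_bilin (M : ℝ) (y : E4) : (boostedKerrBackground 1 0 M 0).bilin y = Kerr.bilin M 0 y :=
  boostedKerrBilin_one_zero M 0 y

/-- Membership in the hole background's domain (the Schwarzschild exterior `{‖ỹ‖ > 2M}`). -/
theorem mem_holeDomain (hM : 0 ≤ M) {y : E4} :
    y ∈ (boostedKerrBackground 1 0 M 0).domain ↔ 2 * M < E4.spatialNorm y := by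
  show y ∈ boostedKerrExterior 1 0 M 0 ↔ _
  rw [mem_boostedKerrExterior, poincareInv_one_zero]
  exact mem_region_iff hM

/-- The late region of the hole background is `{y⁰ > τ}`. -/
theorem mem_holeLateRegion {τ : ℝ} {y : (boostedKerrBackground 1 0 M 0).domain} :
    y ∈ (boostedKerrBackground 1 0 M 0).lateRegion τ ↔ τ < y.1 0 := by
  rw [ModelBackground.mem_lateRegion, holeBackground_time]

/-- The late region of the hole background is open. -/
theorem isOpen_holeLateRegion (M τ : ℝ) : IsOpen ((boostedKerrBackground 1 0 M 0).lateRegion τ) := by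
  have : (boostedKerrBackground 1 0 M 0).lateRegion τ = {y | τ < y.1 0} := Set.ext fun _ ↦ mem_holeLateRegion
  rw [this]
  exact isOpen_lt continuous_const ((PiLp.continuous_apply 2 _ 0).comp continuous_subtype_val)

end Background

/-! ## Two facts on the bending (calculus of part 5 in the coordinates of part 6) -/

section BendFacts

variable {M : ℝ}

/-- **`d(bend ∘ (x⁰, ‖x̃‖))(e₀) = ∂_t bend`**: along `e₀` only the time argument moves. -/
theorem fderiv_bendAt_basisVector (hM : 0 < M) {x : E4} (hx : 2 * M < E4.spatialNorm x) :
    fderiv ℝ (fun y : E4 ↦ bend M (y 0) (E4.spatialNorm y)) x (E4.basisVector 0) =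
      deriv (fun t ↦ bend M t (E4.spatialNorm x)) (x 0) := by
  set g : E4 → ℝ := fun y ↦ bend M (y 0) (E4.spatialNorm y) with hg
  have hgd : DifferentiableAt ℝ g x := (contDiffAt_bendAt hM hx (n := 1)).differentiableAt (by norm_num)
  -- restrict to the line `s ↦ x + s e₀`
  have hline : HasDerivAt (fun s : ℝ ↦ x + s • E4.basisVector 0) (E4.basisVector 0) 0 := by
    simpa using ((hasDerivAt_id (0 : ℝ)).smul_const (E4.basisVector 0)).const_add x
  have h1 : HasDerivAt (g ∘ fun s : ℝ ↦ x + s • E4.basisVector 0) (fderiv ℝ g x (E4.basisVector 0)) 0 :=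
    hgd.hasFDerivAt.comp_hasDerivAt_of_eq (0 : ℝ) hline (by simp)
  have h2 : (g ∘ fun s : ℝ ↦ x + s • E4.basisVector 0) = fun s ↦ bend M (x 0 + s) (E4.spatialNorm x) := by
    funext s
    simp only [hg, Function.comp_apply, spatialNorm_add_smul_basisVector]
    congr 1
    simp
  rw [h2] at h1
  have h3 : HasDerivAt (fun s : ℝ ↦ bend M (x 0 + s) (E4.spatialNorm x))
      (deriv (fun t ↦ bend M t (E4.spatialNorm x)) (x 0)) 0 := by
    have hb := (hasDerivAt_bend_t hM (x 0) (E4.spatialNorm x)).differentiableAt.hasDerivAt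
    have hb' : HasDerivAt (fun t ↦ bend M t (E4.spatialNorm x))
        (deriv (fun t ↦ bend M t (E4.spatialNorm x)) (x 0)) (x 0 + 0) := by
      rw [add_zero]; exact hb
    exact hb'.comp_const_add (x 0) 0
  exact h1.unique h3

end BendFacts

/-! ## The hole chart: smoothness and open embedding -/

section Chart

variable {M T₀ : ℝ}
  (Ψ : (boostedKerrBackground 1 0 M 0).domain → Kerr.region 0 (Kerr.rPlus M 0))
  (hΨ : ∀ y, (Ψ y : E4) = holeMap M T₀ y)

/-- `holeMap` lands in the Schwarzschild exterior. -/
theorem holeMap_mem_region (hM : 0 < M) (T₀ : ℝ) {x : E4} (hx : 2 * M < E4.spatialNorm x) :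
    holeMap M T₀ x ∈ Kerr.region 0 (Kerr.rPlus M 0) := by
  rw [mem_region_iff hM.le, spatialNorm_holeMap]; exact hx

include hΨ in
/-- The hole chart is `C^∞`. -/
theorem contMDiff_holeChart (hM : 0 < M) : ContMDiff 𝓘(ℝ, E4) 𝓘(ℝ, E4) ∞ Ψ :=
  contMDiff_of_rep Ψ (holeMap M T₀) hΨ fun y ↦ contDiffAt_holeMap hM T₀ ((mem_holeDomain hM.le).1 y.2)

/-- Near a late point the hole map is the bent map. -/
theorem holeMap_eventuallyEq_bentMap (M : ℝ) {T₀ : ℝ} {y : E4} (hy : T₀ + 1 < y 0) :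
    holeMap M T₀ =ᶠ[𝓝 y] bentMap M := by
  have hopen : IsOpen {z : E4 | T₀ + 1 < z 0} := isOpen_lt continuous_const (PiLp.continuous_apply 2 _ 0)
  filter_upwards [hopen.mem_nhds hy] with z hz
  exact holeMap_of_le M (le_of_lt hz)

/-- **The bent map maps neighbourhoods onto neighbourhoods** at late points (`1 + ∂_t bend ≥ 1/2`). -/
theorem map_nhds_bentMap (hM : 0 < M)
    (hmono : ∀ t r : ℝ, T₀ ≤ t → 2 * M < r → |deriv (fun t ↦ bend M t r) t| ≤ 1 / 2)
    {y : E4} (hy0 : T₀ ≤ y 0) (hy : 2 * M < E4.spatialNorm y) :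
    map (bentMap M) (𝓝 y) = 𝓝 (bentMap M y) := by
  have hcd : ContDiffAt ℝ 1 (fun z : E4 ↦ bend M (z 0) (E4.spatialNorm z)) y := contDiffAt_bendAt hM hy
  have hstrict := hcd.hasStrictFDerivAt one_ne_zero
  have h1 : 1 + fderiv ℝ (fun z : E4 ↦ bend M (z 0) (E4.spatialNorm z)) y (E4.basisVector 0) ≠ 0 := by
    rw [fderiv_bendAt_basisVector hM hy]
    have := hmono (y 0) (E4.spatialNorm y) hy0 hy
    have h' := neg_abs_le (deriv (fun t ↦ bend M t (E4.spatialNorm y)) (y 0))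
    linarith
  exact map_nhds_timeShift hstrict h1

include hΨ in
/-- **The hole chart is an open embedding on the late region `{y⁰ > T₀ + 1}`** (injective by the fibrewise
strict monotonicity of `t ↦ t + bend M t r`, open by the inverse function theorem). -/
theorem isOpenEmbedding_restrict_holeChart (hM : 0 < M)
    (hmono : ∀ t r : ℝ, T₀ ≤ t → 2 * M < r → |deriv (fun t ↦ bend M t r) t| ≤ 1 / 2) :
    Topology.IsOpenEmbedding (((boostedKerrBackground 1 0 M 0).lateRegion (T₀ + 1)).restrict Ψ) := by
  refine isOpenEmbedding_restrict_of_coords Ψ (holeMap M T₀) hΨ (isOpen_holeLateRegion M _) ?_ ?_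
  · intro y hy
    have hy0 : T₀ + 1 < y.1 0 := mem_holeLateRegion.1 hy
    have hyr : 2 * M < E4.spatialNorm y.1 := (mem_holeDomain hM.le).1 y.2
    have hev := holeMap_eventuallyEq_bentMap M hy0
    rw [Filter.map_congr hev, hev.eq_of_nhds]
    exact map_nhds_bentMap hM hmono (by linarith) hyr
  · intro y hy y' hy' h
    have hy0 : T₀ + 1 < y.1 0 := mem_holeLateRegion.1 hy
    have hy0' : T₀ + 1 < y'.1 0 := mem_holeLateRegion.1 hy'
    have hyr : 2 * M < E4.spatialNorm y.1 := (mem_holeDomain hM.le).1 y.2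
    change holeMap M T₀ y.1 = holeMap M T₀ y'.1 at h
    rw [holeMap_of_le M hy0.le, holeMap_of_le M hy0'.le] at h
    have hs : E4.spatial y.1 = E4.spatial y'.1 := by
      rw [← spatial_bentMap M y.1, ← spatial_bentMap M y'.1, h]
    have hn : E4.spatialNorm y.1 = E4.spatialNorm y'.1 := by unfold E4.spatialNorm; rw [hs]
    have ht : y.1 0 + bend M (y.1 0) (E4.spatialNorm y.1) = y'.1 0 + bend M (y'.1 0) (E4.spatialNorm y.1) := by
      have := congrArg (fun z : E4 ↦ z 0) h
      simp only [bentMap_apply_zero] at this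
      rwa [← hn] at this
    have h0 : y.1 0 = y'.1 0 :=
      (strictMonoOn_add_bend hM hmono hyr).injOn (show T₀ ≤ y.1 0 by linarith)
        (show T₀ ≤ y'.1 0 by linarith) ht
    exact Subtype.ext (E4.ext_of_apply_zero_of_spatial h0 hs)

end Chart

/-! ## The exact zone: vanishing deviation, vanishing truncated deviations -/

section Exact

variable {M T₀ : ℝ}
  (Ψ : (boostedKerrBackground 1 0 M 0).domain → Kerr.region 0 (Kerr.rPlus M 0))
  (hΨ : ∀ y, (Ψ y : E4) = holeMap M T₀ y)

/-- On the late exact zone `{y⁰ > T₀ + 1, ‖ỹ‖ < S(y⁰)}` the hole map is the identity near every point. -/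
theorem holeMap_eventuallyEq_id (hM : 0 < M) {y : E4} (hy0 : T₀ + 1 < y 0)
    (hyr : E4.spatialNorm y < exactRadius M (y 0)) : holeMap M T₀ =ᶠ[𝓝 y] id := by
  have hc0 : Continuous fun z : E4 ↦ z 0 := PiLp.continuous_apply 2 _ 0
  have hopen : IsOpen {z : E4 | T₀ + 1 < z 0 ∧ E4.spatialNorm z < exactRadius M (z 0)} :=
    (isOpen_lt continuous_const hc0).inter
      (isOpen_lt (continuous_norm.comp E4.spatial.continuous) ((continuous_exactRadius M).comp hc0))
  filter_upwards [hopen.mem_nhds ⟨hy0, hyr⟩] with z hz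
  rw [holeMap_of_le M hz.1.le, bentMap_eq, bend_eq_zero_of_le hM hz.2.le, zero_smul, add_zero, id]

variable [Kerr.Facts]

include hΨ in
/-- **On the exact zone the pullback of `g_{M,0}` along the hole chart is `g_{M,0}` itself.** -/
theorem pullback_holeChart_of_lt (hM : 0 < M) (y : (boostedKerrBackground 1 0 M 0).domain)
    (hy0 : T₀ + 1 < y.1 0) (hyr : E4.spatialNorm y.1 < exactRadius M (y.1 0)) (v w : E4) :
    (Kerr.smoothMetric M 0 (Kerr.rPlus M 0)).val (Ψ y) (mfderiv 𝓘(ℝ, E4) 𝓘(ℝ, E4) Ψ y v)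
        (mfderiv 𝓘(ℝ, E4) 𝓘(ℝ, E4) Ψ y w) = Kerr.bilin M 0 y.1 v w := by
  have hev := holeMap_eventuallyEq_id hM hy0 hyr
  have hdiff : DifferentiableAt ℝ (holeMap M T₀) y.1 :=
    (contDiffAt_holeMap hM T₀ ((mem_holeDomain hM.le).1 y.2) (n := 1)).differentiableAt (by norm_num)
  have hfd : fderiv ℝ (holeMap M T₀) y.1 = ContinuousLinearMap.id ℝ E4 := by
    rw [hev.fderiv_eq, fderiv_id]
  have hpt : (Ψ y : E4) = y.1 := by rw [hΨ y, hev.eq_of_nhds, id]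
  rw [Kerr.smoothMetric_val, hpt, mfderiv_apply_of_rep Ψ (holeMap M T₀) hΨ y hdiff,
    mfderiv_apply_of_rep Ψ (holeMap M T₀) hΨ y hdiff, hfd]
  rfl

include hΨ in
/-- On the exact zone the extended deviation of the hole chart from the hole background vanishes with
all its derivatives. -/
theorem iteratedFDeriv_deviationExtend_holeChart (hM : 0 < M) {z : E4} (hz : 2 * M < E4.spatialNorm z)
    (hz0 : T₀ + 1 < z 0) (hzr : E4.spatialNorm z < exactRadius M (z 0)) (m : ℕ) :
    iteratedFDeriv ℝ m ((Kerr.spacetime M 0 (Kerr.rPlus M 0) hM.le).deviationExtend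
      (boostedKerrBackground 1 0 M 0) Ψ) z = 0 := by
  -- the deviation vanishes on the open set `N = {2M < ‖ỹ‖, T₀ + 1 < y⁰, ‖ỹ‖ < S(y⁰)}`
  have hc0 : Continuous fun y : E4 ↦ y 0 := PiLp.continuous_apply 2 _ 0
  have hN : IsOpen {y : E4 | 2 * M < E4.spatialNorm y ∧ T₀ + 1 < y 0 ∧ E4.spatialNorm y < exactRadius M (y 0)} :=
    (isOpen_lt continuous_const (continuous_norm.comp E4.spatial.continuous)).inter ((isOpen_lt continuous_const hc0).inter
      (isOpen_lt (continuous_norm.comp E4.spatial.continuous) ((continuous_exactRadius M).comp hc0)))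
  have hzero : ∀ y ∈ {y : E4 | 2 * M < E4.spatialNorm y ∧ T₀ + 1 < y 0 ∧ E4.spatialNorm y < exactRadius M (y 0)},
      (Kerr.spacetime M 0 (Kerr.rPlus M 0) hM.le).deviationExtend (boostedKerrBackground 1 0 M 0) Ψ y = 0 := by
    intro y hy
    have hyd : y ∈ (boostedKerrBackground 1 0 M 0).domain := (mem_holeDomain hM.le).2 hy.1
    rw [(Kerr.spacetime M 0 (Kerr.rPlus M 0) hM.le).deviationExtend_coe (boostedKerrBackground 1 0 M 0) Ψ ⟨y, hyd⟩]
    refine ContinuousLinearMap.ext fun v ↦ ContinuousLinearMap.ext fun w ↦ ?_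
    rw [Spacetime.deviation_apply, holeBackground_bilin]
    change (Kerr.smoothMetric M 0 (Kerr.rPlus M 0)).val (Ψ ⟨y, hyd⟩) (mfderiv 𝓘(ℝ, E4) 𝓘(ℝ, E4) Ψ ⟨y, hyd⟩ v)
        (mfderiv 𝓘(ℝ, E4) 𝓘(ℝ, E4) Ψ ⟨y, hyd⟩ w) - Kerr.bilin M 0 y v w = 0
    rw [pullback_holeChart_of_lt Ψ hΨ hM ⟨y, hyd⟩ hy.2.1 hy.2.2 v w, sub_self]
  have hev : (Kerr.spacetime M 0 (Kerr.rPlus M 0) hM.le).deviationExtend (boostedKerrBackground 1 0 M 0) Ψ =ᶠ[𝓝 z]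
      fun _ ↦ 0 := by
    filter_upwards [hN.mem_nhds ⟨hz, hz0, hzr⟩] with y hy
    exact hzero y hy
  rw [(hev.iteratedFDeriv ℝ m).eq_of_nhds]
  simp

include hΨ in
/-- **The truncated `Cᵏ` deviation of the hole chart vanishes** on every late slab `{y⁰ = τ}`, `τ > T₀ + 1`,
truncated inside the exact zone, `R < S(τ)`. -/
theorem truncDeviationCk_holeChart_eq_zero (hM : 0 < M) (k : ℕ) {R τ : ℝ} (hτ : T₀ + 1 < τ)
    (hR : R < exactRadius M τ) :
    (Kerr.spacetime M 0 (Kerr.rPlus M 0) hM.le).truncDeviationCk (boostedKerrBackground 1 0 M 0) Ψ k R τ = 0 := by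
  refine le_antisymm (iSup₂_le fun m _ ↦ iSup₂_le fun z hz ↦ ?_) bot_le
  obtain ⟨x, hx, rfl⟩ := hz
  rw [ModelBackground.mem_truncTimeSlab, holeBackground_time, holeBackground_radius] at hx
  have hx2 : 2 * M < E4.spatialNorm x.1 := (mem_holeDomain hM.le).1 x.2
  have hx0 : T₀ + 1 < x.1 0 := by rw [hx.1]; exact hτ
  have hxr : E4.spatialNorm x.1 < exactRadius M (x.1 0) := by rw [hx.1]; exact hx.2.trans_lt hR
  rw [iteratedFDeriv_deviationExtend_holeChart Ψ hΨ hM hx2 hx0 hxr m, enorm_zero]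

include hΨ in
/-- Hence the truncated deviations along any radii eventually inside the exact zone tend to `0`. -/
theorem tendsto_truncDeviationCk_holeChart (hM : 0 < M) (k : ℕ) {R : ℝ → ℝ}
    (hR : ∀ᶠ τ in atTop, R τ < exactRadius M τ) :
    Tendsto (fun τ ↦ (Kerr.spacetime M 0 (Kerr.rPlus M 0) hM.le).truncDeviationCk
      (boostedKerrBackground 1 0 M 0) Ψ k (R τ) τ) atTop (𝓝 0) := by
  refine (tendsto_const_nhds (x := (0 : ENNReal))).congr' ?_
  filter_upwards [hR, eventually_gt_atTop (T₀ + 1)] with τ hRτ hτ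
  exact (truncDeviationCk_holeChart_eq_zero Ψ hΨ hM k hτ hRτ).symm

end Exact

/-! ## Images of the hole chart in ingoing Kerr–Schild coordinates -/

section Images

variable {M T₀ : ℝ}
  (Ψ : (boostedKerrBackground 1 0 M 0).domain → Kerr.region 0 (Kerr.rPlus M 0))
  (hΨ : ∀ y, (Ψ y : E4) = holeMap M T₀ y)

include hΨ in
/-- A point `p` of the exterior with `p⁰ = t + bend M t ‖p̃‖`, `t ≥ T₀ + 1`, is the image of `(t, p̃)`. -/
theorem mem_image_holeChart (hM : 0 < M) {A : Set (boostedKerrBackground 1 0 M 0).domain}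
    (p : Kerr.region 0 (Kerr.rPlus M 0)) {t : ℝ} (ht : T₀ + 1 ≤ t)
    (hp : p.1 0 = t + bend M t (E4.spatialNorm p.1))
    (hA : ∀ (y : (boostedKerrBackground 1 0 M 0).domain), y.1 = p.1 + (t - p.1 0) • E4.basisVector 0 → y ∈ A) :
    p ∈ Ψ '' A := by
  set y : E4 := p.1 + (t - p.1 0) • E4.basisVector 0 with hy
  have hyr : E4.spatialNorm y = E4.spatialNorm p.1 := spatialNorm_add_smul_basisVector _ _
  have hy0 : y 0 = t := by rw [hy]; simp
  have hyd : y ∈ (boostedKerrBackground 1 0 M 0).domain := by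
    rw [mem_holeDomain hM.le, hyr]; exact (mem_region_iff hM.le).1 p.2
  refine ⟨⟨y, hyd⟩, hA ⟨y, hyd⟩ rfl, Subtype.ext ?_⟩
  have h0 : t - p.1 0 + bend M t (E4.spatialNorm p.1) = 0 := by linarith
  rw [hΨ]
  show holeMap M T₀ y = p.1
  rw [holeMap_of_le M (by rw [hy0]; exact ht), bentMap_eq, hy0, hyr, hy, add_assoc, ← add_smul, h0, zero_smul,
    add_zero]

include hΨ in
/-- **Image of the late region**: `Ψ({y⁰ > T₀ + 1}) = {p | (T₀ + 1) + bend M (T₀ + 1) ‖p̃‖ < p⁰}`. -/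
theorem image_holeChart_lateRegion (hM : 0 < M)
    (hmono : ∀ t r : ℝ, T₀ ≤ t → 2 * M < r → |deriv (fun t ↦ bend M t r) t| ≤ 1 / 2) :
    Ψ '' (boostedKerrBackground 1 0 M 0).lateRegion (T₀ + 1) =
      {p | (T₀ + 1) + bend M (T₀ + 1) (E4.spatialNorm p.1) < p.1 0} := by
  ext p
  constructor
  · rintro ⟨y, hy, rfl⟩
    have hy0 : T₀ + 1 < y.1 0 := mem_holeLateRegion.1 hy
    have hyr : 2 * M < E4.spatialNorm y.1 := (mem_holeDomain hM.le).1 y.2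
    show (T₀ + 1) + bend M (T₀ + 1) (E4.spatialNorm (Ψ y).1) < (Ψ y).1 0
    rw [hΨ, holeMap_of_le M hy0.le, spatialNorm_bentMap, bentMap_apply_zero]
    exact strictMonoOn_add_bend hM hmono hyr (show T₀ ≤ T₀ + 1 by linarith) (show T₀ ≤ y.1 0 by linarith) hy0
  · intro hp
    obtain ⟨t, ht, hpt⟩ := exists_add_bend_eq hM hp
    refine mem_image_holeChart Ψ hΨ hM p ht.le hpt.symm fun y hy ↦ ?_
    rw [mem_holeLateRegion, hy]
    simpa using ht

include hΨ in
/-- **Image of a late time slab**: `Ψ({y⁰ = τ}) = {p | p⁰ = τ + bend M τ ‖p̃‖}` for `τ ≥ T₀ + 1`. -/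
theorem image_holeChart_timeSlab (hM : 0 < M) {τ : ℝ} (hτ : T₀ + 1 ≤ τ) :
    Ψ '' (boostedKerrBackground 1 0 M 0).timeSlab τ = {p | p.1 0 = τ + bend M τ (E4.spatialNorm p.1)} := by
  ext p
  constructor
  · rintro ⟨y, hy, rfl⟩
    rw [ModelBackground.mem_timeSlab, holeBackground_time] at hy
    show (Ψ y).1 0 = τ + bend M τ (E4.spatialNorm (Ψ y).1)
    rw [hΨ, holeMap_of_le M (by rw [hy]; exact hτ), spatialNorm_bentMap, bentMap_apply_zero, hy]
  · intro hp
    refine mem_image_holeChart Ψ hΨ hM p hτ hp fun y hy ↦ ?_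
    rw [ModelBackground.mem_timeSlab, holeBackground_time, hy]
    simp

include hΨ in
/-- **Image of a truncated late slab inside the exact zone**: `Ψ({y⁰ = τ, ‖ỹ‖ ≤ R}) = {p | p⁰ = τ, ‖p̃‖ ≤ R}`
for `τ ≥ T₀ + 1`, `R ≤ S(τ)`. -/
theorem image_holeChart_truncTimeSlab (hM : 0 < M) {R τ : ℝ} (hτ : T₀ + 1 ≤ τ) (hR : R ≤ exactRadius M τ) :
    Ψ '' (boostedKerrBackground 1 0 M 0).truncTimeSlab R τ = {p | p.1 0 = τ ∧ E4.spatialNorm p.1 ≤ R} := by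
  ext p
  constructor
  · rintro ⟨y, hy, rfl⟩
    rw [ModelBackground.mem_truncTimeSlab, holeBackground_time, holeBackground_radius] at hy
    have hb : bend M (y.1 0) (E4.spatialNorm y.1) = 0 := bend_eq_zero_of_le hM (by rw [hy.1]; exact hy.2.trans hR)
    show (Ψ y).1 0 = τ ∧ E4.spatialNorm (Ψ y).1 ≤ R
    rw [hΨ, holeMap_of_le M (by rw [hy.1]; exact hτ), spatialNorm_bentMap, bentMap_apply_zero, hb, add_zero]
    exact hy
  · rintro ⟨hp0, hpR⟩
    have hb : bend M τ (E4.spatialNorm p.1) = 0 := bend_eq_zero_of_le hM (hpR.trans hR)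
    refine mem_image_holeChart Ψ hΨ hM p hτ (by rw [hb, add_zero]; exact hp0) fun y hy ↦ ?_
    rw [ModelBackground.mem_truncTimeSlab, holeBackground_time, holeBackground_radius, hy,
      spatialNorm_add_smul_basisVector]
    exact ⟨by simp, hpR⟩

include hΨ in
/-- **Image of the certified near zone**: for radii `R ≤ S` and `τ₁ ≥ T₀ + 1`,
`Ψ({y⁰ > τ₁, ‖ỹ‖ ≤ R(y⁰)}) = {p | p⁰ > τ₁, ‖p̃‖ ≤ R(p⁰)}`. -/
theorem image_holeChart_certified (hM : 0 < M) {τ₁ : ℝ} (hτ₁ : T₀ + 1 ≤ τ₁) {R : ℝ → ℝ}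
    (hR : ∀ t, R t ≤ exactRadius M t) :
    Ψ '' {y | τ₁ < (boostedKerrBackground 1 0 M 0).time y.1 ∧
        (boostedKerrBackground 1 0 M 0).radius y.1 ≤ R ((boostedKerrBackground 1 0 M 0).time y.1)} =
      {p | τ₁ < p.1 0 ∧ E4.spatialNorm p.1 ≤ R (p.1 0)} := by
  ext p
  constructor
  · rintro ⟨y, hy, rfl⟩
    simp only [mem_setOf_eq, holeBackground_time, holeBackground_radius] at hy
    have hb : bend M (y.1 0) (E4.spatialNorm y.1) = 0 := bend_eq_zero_of_le hM (hy.2.trans (hR _))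
    show τ₁ < (Ψ y).1 0 ∧ E4.spatialNorm (Ψ y).1 ≤ R ((Ψ y).1 0)
    rw [hΨ, holeMap_of_le M (by linarith [hy.1]), spatialNorm_bentMap, bentMap_apply_zero, hb, add_zero]
    exact hy
  · rintro ⟨hp0, hpR⟩
    have hb : bend M (p.1 0) (E4.spatialNorm p.1) = 0 := bend_eq_zero_of_le hM (hpR.trans (hR _))
    refine mem_image_holeChart Ψ hΨ hM p (t := p.1 0) (by linarith) (by rw [hb, add_zero]) fun y hy ↦ ?_
    simp only [mem_setOf_eq, holeBackground_time, holeBackground_radius, hy, spatialNorm_add_smul_basisVector]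
    constructor
    · simpa using hp0
    · simpa using hpR

end Images

/-- **Anchor of part 8** (registered sub-goal of `stub_regionOneDecomposition`): the truncated `Cᵏ`
deviations of the hole chart vanish on late slabs truncated inside the exact zone. -/
theorem regionOneHoleLate_anchor : ∀ [Kerr.Facts] (M T₀ : ℝ) (hM : 0 < M) (Ψ : (boostedKerrBackground 1 0 M 0).domain → Kerr.region 0 (Kerr.rPlus M 0)), (∀ y, (Ψ y : E4) = holeMap M T₀ y) → ∀ (k : ℕ) (R τ : ℝ), T₀ + 1 < τ → R < exactRadius M τ → (Kerr.spacetime M 0 (Kerr.rPlus M 0) hM.le).truncDeviationCk (boostedKerrBackground 1 0 M 0) Ψ k R τ = 0 := by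
  intro _ M T₀ hM Ψ hΨ k R τ hτ hR
  exact truncDeviationCk_holeChart_eq_zero Ψ hΨ hM k hτ hR

end Summit.FinalStateConjecture.FinalStateConjecture.Theorems.SwallowTheDatum.UniversalWitnessFamily

end
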